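import Literature.Probability.Percolation.BondInterfaceFaceDomainULC
import HarnessLib

/-!
# Face kernel (K1), closed cells inside the face domain; compact path-connected hulls

Route `CardyComplexCone` (sub-problem `CriticalPhenomena/CardyFormulaZ2`), crux
`Summit.CriticalPhenomena.CardyFormulaZ2.Theses.CardyComplexCone.ParafermionToSLESixFamilies`
(item stmt-CriticalPhenomena-11389), line `face-kernel-k1` (lead c4), helpers of the assembly stub
`stub_percFaceK1_of`.

* `mem_faceDomain_of_W_ne_zero` — a point of the CLOSED cell of a face of non-zero winding number
  (for the boundary cycle from `e_a`) lies in the face domain, provided every closed cell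
  containing the point is an inner face (so that the point is off the boundary polygon, which
  runs along sides of non-inner faces): the open cell is inside
  (`cell_subset_faceDomain_of_W_ne_zero`) and the point is joined to the cell centre off the
  polygon.
* `exists_isCompact_isPathConnected_superset` — a compact subset of an open path-connected
  planar set lies in a compact path-connected subset of it (finitely many closed discs joined by
  paths).
-/

noncomputable section

open Filter Set Metric
open Literature.Probability Literature.Probability.LatticeModels Literature.Probability.Percolation
open Literature.Probability.LatticeModels.DiscreteDobrushin Literature.Probability.LatticeModels.Mesh
open Literature.Probability.RandomPlanarGeometry

namespace Summit.CriticalPhenomena.CardyFormulaZ2.Cruxes.ParafermionToSLESixFamilies.FaceKernel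

variable {E : DiscreteDobrushin}

/-- **A point all of whose closed cells are inner is off the boundary polygon**: the polygon of
the boundary cycle runs along the dart segments, each of which lies in the closed cell of the
non-inner face on its right. -/
theorem not_mem_range_polygonLoop_of_forall_isInnerFace (hE : E.IsZdAdmissible) {z : ℂ}
    (hin : ∀ F' : Site 2, z ∈ closure (cell E.δ (F' 0) (F' 1)) → E.IsInnerFace F') :
    z ∉ range (polygonLoop (bverts hE (isOutEdge_startCorner hE))) := by
  intro hz
  have hzs := range_polygonLoop_bverts_subset_strace hE hz
  obtain ⟨t, -, ht⟩ := (bcycle hE).mem_strace_iff.1 hzs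
  rw [show (bcycle hE).v t = toZ2 (E.bwalk (startCorner hE) (0 + t % _)).1 from bloop_v t,
    show (bcycle hE).v (t + 1) = toZ2 ((E.bwalk (startCorner hE) (0 + t % _)).1 +
      cornerUnit (E.bwalk (startCorner hE) (0 + t % _)).2) from bloop_v_succ t,
    ← meshPoint_eq_mul_latC, ← meshPoint_eq_mul_latC] at ht
  set p := E.bwalk (startCorner hE) (0 + t % bperiod hE (isOutEdge_startCorner hE)) with hp
  have hout := isOutEdge_bwalk (isOutEdge_startCorner hE)
    (0 + t % bperiod hE (isOutEdge_startCorner hE))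
  rw [← hp] at hout
  have hseg := segment_subset_closure_cell_of_isCorner hE.delta_pos (isCorner_faceAt p.1 (p.2 + 3))
    ((isCorner_add_faceAt_iff p.1 p.2 (p.2 + 3)).2 (Or.inr rfl)) ht
  exact hout.2 (hin _ hseg)

/-- **Closed cells of faces of non-zero winding number lie in the face domain** (at points all of
whose closed cells are inner). For a regular domain (`Ω` open; exterior connected, unbounded;
`∂Ω ⊆ closure of the exterior` — all true for Jordan domains): the open cell is inside
(`cell_subset_faceDomain_of_W_ne_zero`), the point is off the polygon
(`not_mem_range_polygonLoop_of_forall_isInnerFace`) and is joined to the cell centre along a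
segment whose open part lies in the open cell, so its complementary component is the bounded
component of the centre. -/
theorem mem_faceDomain_of_W_ne_zero :
    ∀ {E : DiscreteDobrushin} (hE : E.IsZdAdmissible) (hΩo : IsOpen E.Ω)
      (hext : IsConnected (closure E.Ω)ᶜ) (hunb : ¬ Bornology.IsBounded (closure E.Ω)ᶜ)
      (hfr : frontier E.Ω ⊆ closure (closure E.Ω)ᶜ) {F : Site 2},
      (bcycle hE).W (toZ2 F) ≠ 0 → ∀ {z : ℂ}, z ∈ closure (cell E.δ (F 0) (F 1)) →
      (∀ F' : Site 2, z ∈ closure (cell E.δ (F' 0) (F' 1)) → E.IsInnerFace F') →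
      z ∈ (faceDomain hE hΩo hext hunb hfr).carrier := by
  intro E hE hΩo hext hunb hfr F hW z hz hin
  have hδ := hE.delta_pos
  have hzP := not_mem_range_polygonLoop_of_forall_isInnerFace hE hin
  set c := cellCenter E.δ (F 0) (F 1) with hc_def
  have hc : c ∈ cell E.δ (F 0) (F 1) := cellCenter_mem_cell hδ _ _
  have hcin : c ∈ (faceDomain hE hΩo hext hunb hfr).carrier :=
    cell_subset_faceDomain_of_W_ne_zero hE hΩo hext hunb hfr hW hc
  rw [faceDomain_carrier, mem_polygonDomain_iff] at hcin ⊢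
  obtain ⟨hcP, hbdd⟩ := hcin
  refine ⟨hzP, ?_⟩
  have hdis := disjoint_cell_range_polygonLoop_bverts hE (F 0) (F 1)
  have hsub : segment ℝ c z ⊆ (range (polygonLoop (bverts hE (isOutEdge_startCorner hE))))ᶜ := by
    rw [← insert_endpoints_openSegment]
    intro x hx
    rcases hx with rfl | rfl | hx
    · exact hcP
    · exact hzP
    · exact Set.disjoint_left.1 hdis (openSegment_subset_cell_of_mem_closure _ _ hc hz hx)
  have hzc : z ∈ connectedComponentIn
      (range (polygonLoop (bverts hE (isOutEdge_startCorner hE))))ᶜ c :=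
    (convex_segment c z).isPreconnected.subset_connectedComponentIn (left_mem_segment ℝ c z) hsub
      (right_mem_segment ℝ c z)
  rw [← connectedComponentIn_eq hzc]
  exact hbdd

/-- The range of a path is path-connected. -/
theorem isPathConnected_range_path {x y : ℂ} (γ : Path x y) : IsPathConnected (range γ) := by
  have := isPathConnected_range γ.continuous_extend
  rwa [Path.extend_range] at this

/-- **Compact path-connected hull.** A nonempty compact subset `K` of an open path-connected
planar set `U` lies in a compact path-connected subset of `U`: cover `K` by finitely many closed
discs inside `U` and join their centres to a base point by paths in `U`. -/
theorem exists_isCompact_isPathConnected_superset {U K : Set ℂ} (hU : IsOpen U)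
    (hUc : IsPathConnected U) (hK : IsCompact K) (hKU : K ⊆ U) (hne : K.Nonempty) :
    ∃ K' : Set ℂ, IsCompact K' ∧ IsPathConnected K' ∧ K ⊆ K' ∧ K' ⊆ U := by
  classical
  -- closed discs inside `U`
  have hr : ∀ z ∈ K, ∃ r > 0, closedBall z r ⊆ U := fun z hz => by
    obtain ⟨r, hr, hb⟩ := Metric.isOpen_iff.1 hU z (hKU hz)
    exact ⟨r / 2, by positivity, (closedBall_subset_ball (by linarith)).trans hb⟩
  choose! r hr hrU using hr
  obtain ⟨t, htK, hcover⟩ := hK.elim_nhds_subcover (fun z => ball z (r z))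
    (fun z hz => ball_mem_nhds z (hr z hz))
  -- a base point and paths to the centres
  obtain ⟨z₀, hz₀⟩ := hne
  have hJ : ∀ x ∈ K, ∃ γ : Path z₀ x, ∀ s, γ s ∈ U := fun x hx =>
    ⟨(hUc.joinedIn z₀ (hKU hz₀) x (hKU hx)).somePath, (hUc.joinedIn z₀ (hKU hz₀) x (hKU hx)).somePath_mem⟩
  choose γ hγ using hJ
  -- the hull
  set K' : Set ℂ := ⋃ x : t, (range (γ x (htK x x.2)) ∪ closedBall (x : ℂ) (r x)) with hK'
  have hpiece : ∀ x : t, range (γ x (htK x x.2)) ∪ closedBall (x : ℂ) (r x) ⊆ K' := fun x =>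
    subset_iUnion (fun x : t => range (γ x (htK x x.2)) ∪ closedBall (x : ℂ) (r x)) x
  -- some centre
  obtain ⟨x₀, hx₀⟩ : ∃ x, x ∈ t := by
    have := hcover hz₀
    simp only [mem_iUnion] at this
    obtain ⟨x, hx, -⟩ := this
    exact ⟨x, hx⟩
  have hz₀K' : z₀ ∈ K' := hpiece ⟨x₀, hx₀⟩ (Or.inl ⟨0, (γ x₀ (htK x₀ hx₀)).source⟩)
  refine ⟨K', ?_, ?_, ?_, ?_⟩
  · exact isCompact_iUnion fun x =>
      (isCompact_range (γ x (htK x x.2)).continuous).union (isCompact_closedBall _ _)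
  · refine ⟨z₀, hz₀K', fun {y} hy => ?_⟩
    rw [hK', mem_iUnion] at hy
    obtain ⟨x, hy⟩ := hy
    have hx1 : (x : ℂ) ∈ range (γ x (htK x x.2)) := ⟨1, (γ x (htK x x.2)).target⟩
    have hx0 : z₀ ∈ range (γ x (htK x x.2)) := ⟨0, (γ x (htK x x.2)).source⟩
    rcases hy with hy | hy
    · exact ((isPathConnected_range_path _).joinedIn z₀ hx0 y hy).mono
        (subset_union_left.trans (hpiece x))
    · have h1 : JoinedIn K' z₀ x :=
        ((isPathConnected_range_path _).joinedIn z₀ hx0 x hx1).mono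
          (subset_union_left.trans (hpiece x))
      have h2 : JoinedIn K' x y :=
        (((convex_closedBall (x : ℂ) (r x)).isPathConnected
          ⟨x, mem_closedBall_self (hr x (htK x x.2)).le⟩).joinedIn x
          (mem_closedBall_self (hr x (htK x x.2)).le) y hy).mono (subset_union_right.trans (hpiece x))
      exact h1.trans h2
  · intro z hz
    have := hcover hz
    simp only [mem_iUnion] at this
    obtain ⟨x, hx, hzx⟩ := this
    exact hpiece ⟨x, hx⟩ (Or.inr (ball_subset_closedBall hzx))
  · rw [hK']
    refine iUnion_subset fun x => union_subset ?_ (hrU x (htK x x.2))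
    rintro _ ⟨s, rfl⟩
    exact hγ x (htK x x.2) s

end Summit.CriticalPhenomena.CardyFormulaZ2.Cruxes.ParafermionToSLESixFamilies.FaceKernel

end
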